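import Summits.Langlands.Langlands.Theses.HolomorphicShadow
import Summits.Langlands.Langlands.Theorems.HolomorphicShadowSectorComplementStubEvenArtinShadowData
import Summits.Langlands.Langlands.Theorems.HolomorphicShadowSectorComplementStubEvenArtinPlaneTransport

/-!
REV 2 (prover-leafhand-langlands-sqrtfivequarticcov-4-g0-0, 2026-08-31): stubs P₁ (`stub_evenArtinShadowData`) and P₃
(`stub_complexToLAdicTransport`) are now THEOREMS OF THE TREE — P₁ = `HolomorphicShadow.EvenArtinData.evenArtinShadowData`
(p798955, unconditional), P₃ = `HolomorphicShadow.complexToLAdicTransport_evenArtinPlane` (p794940, unconditional) — and are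
discharged below by `exact`; the ONLY sorries left are P₂ (`stub_maassDictionaryLAlgebraic`, XL: no classical-Maass-form →
automorphic-representation carrier) and P₄ (`stub_rationalFieldTransport`, L: transport along `K ≃+* ℚ`).

BC3 birth skeleton — child `EvenArtinPlaneOfMaass` of `HolomorphicShadow.SectorComplement` (stmt-Langlands-14623),
crux-strategist planner-cstrat-stmt-Langlands-14623-r1-0, 2026-08-17.  Named stubs (the ONLY sorries) and
`EvenArtinPlaneOfMaass_of : stubs → EvenArtinPlaneOfMaass` kernel-checked.  Context = the route file's (child restated verbatim from Sketch.lean /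
children.json; after the split the `def` is deleted and the namespace line kept, cf. post/).
Cut (4 stubs): B⁺ = `H → plane` ⟸ P₁ Artin data of an even `σ` (= the route's support EvenArtinShadowData, stmt-Langlands-13896, BY NAME)
∧ P₂ the Maass-eigenform dictionary WITH L-ALGEBRAICITY (the route's support MaassEigenformStrongArtin 13895 upgraded by the one clause the
summit's (B) consumes and 13895 omits: `P.1.IsLAlgebraic`, `λ = 1/4` ⇒ parameter `(0,0)`) ∧ P₃ complex ↔ `ℓ`-adic transport of Artin-type
representations with the `ι`-dual Satake normalisation (`satakePolynomial α` for `σ = ι ∘ ρ^∨` ↔ `arithFrobPolyOfSatake ι q 1 α` for `ρ`)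
∧ P₄ transport of the plane statement along the unique `K ≃+* ℚ` (`Module.finrank ℚ K = 1`).  Composition: Artin data (P₁), `H` at that
datum, dictionary (P₂) ⇒ even strong Artin over `ℚ` in L-algebraic form; P₃ ⇒ the plane over `ℚ`; P₄ ⇒ the plane.
-/

set_option linter.dupNamespace false

namespace Summit.Langlands.Langlands.Theses.HolomorphicShadow

open scoped BigOperators Topology Manifold Classical MeasureTheory ProbabilityTheory Matrix InnerProductSpace ComplexConjugate ContinuousMap
open Filter Set Function TopologicalSpace MeasureTheory

/-- Piece B⁺ — the even Artin plane from the even-Maass slice `H` (pre-split stand-in; byte-identical with children.json). -/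
def EvenArtinPlaneOfMaass : Prop :=
  let K0 : ℝ → ℝ := fun x => ∫ t in Set.Ioi (0 : ℝ), Real.exp (-(x * Real.cosh t)); let maass : (ℕ → ℂ) → ℂ → UpperHalfPlane → ℂ := fun a ε z => ∑' n : ℕ, a (n + 1) * ((Real.sqrt z.im * K0 (2 * Real.pi * ((n : ℝ) + 1) * z.im) : ℝ) : ℂ) * (Complex.exp (2 * Real.pi * Complex.I * ((n : ℂ) + 1) * (z.re : ℂ)) + ε * Complex.exp (-(2 * Real.pi * Complex.I * ((n : ℂ) + 1) * (z.re : ℂ)))); let EulerPin : Literature.NumberTheory.GaloisRepresentations.FramedGaloisRep ℚ ℂ 2 → (N : ℕ) → DirichletCharacter ℂ N → (ℕ → ℂ) → Prop := fun σ N χ a => a 1 = 1 ∧ (∀ m n : ℕ, Nat.Coprime m n → a (m * n) = a m * a n) ∧ (∀ p : ℕ, p.Prime → p ∣ N → ∀ j : ℕ, a (p ^ (j + 1)) = 0) ∧ (∀ p : ℕ, p.Prime → ¬ p ∣ N → (∀ j : ℕ, a (p ^ (j + 2)) = a p * a (p ^ (j + 1)) - χ (p : ZMod N) * a (p ^ j))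 ∧ ∀ v : IsDedekindDomain.HeightOneSpectrum (NumberField.RingOfIntegers ℚ), (p : NumberField.RingOfIntegers ℚ) ∈ v.asIdeal → Literature.NumberTheory.GaloisRepresentations.FramedGaloisRep.IsUnramifiedAt v σ ∧ Literature.NumberTheory.GaloisRepresentations.FramedGaloisRep.HasFrobCharpolyAt v (Polynomial.X ^ 2 - Polynomial.C (a p) * Polynomial.X + Polynomial.C (χ (p : ZMod N))) σ); let ParityPin : Literature.NumberTheory.GaloisRepresentations.FramedGaloisRep ℚ ℂ 2 → ℂ → Prop := fun σ ε => ∀ (φ : ℚ →+* ℝ) (c : Field.absoluteGaloisGroup ℚ), Literature.NumberTheory.GaloisRepresentations.IsComplexConjugation φ c → ((σ c : GL (Fin 2) ℂ) : Matrix (Fin 2) (Fin 2) ℂ) = ε • (1 : Matrix (Fin 2) (Fin 2) ℂ); (∀ σ : Literature.NumberTheory.GaloisRepresentations.FramedGaloisRep ℚ ℂ 2, σ.toGaloisRep.IsIrreducible → ∀ (N : ℕ) (χ : DirichletCharacter ℂ N) (ε : ℂ) (a : ℕ → ℂ), 0 < N → (ε = 1 ∨ ε = -1) → ParityPin σ ε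 → (∃ C A : ℝ, ∀ n : ℕ, ‖a n‖ ≤ C * ((n : ℝ) + 1) ^ A) → EulerPin σ N χ a → ∃ L : ℕ, 0 < L ∧ N ∣ L ∧ ∀ γ ∈ CongruenceSubgroup.Gamma0 L, ∀ z : UpperHalfPlane, maass a ε (γ • z) = χ ((((γ : Matrix (Fin 2) (Fin 2) ℤ) 1 1 : ℤ) : ZMod N)) * maass a ε z) → ∀ (K : Type) [Field K] [NumberField K], Module.finrank ℚ K = 1 → ∀ (hcpt : Literature.NumberTheory.Automorphic.isCompact_glFiniteIntegralLevel 2 K) (ℓ : ℕ) [Fact ℓ.Prime] (ι : PadicAlgCl ℓ ≃+* ℂ) (ρ : Literature.NumberTheory.GaloisRepresentations.FramedGaloisRep K (PadicAlgCl ℓ) 2), ρ.toGaloisRep.IsIrreducible → IsOpen (ρ.toMonoidHom.ker : Set (Field.absoluteGaloisGroup K)) → (∀ (φ : K →+* ℝ) (c : Field.absoluteGaloisGroup K), Literature.NumberTheory.GaloisRepresentations.IsComplexConjugation φ c → Matrix.GeneralLinearGroup.det (ρ c) = 1) → ∃ π : Literature.NumberTheory.Automorphic.CuspidalAutomorphicRepData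 2 K hcpt, π.1.IsLAlgebraic ∧ ∀ᶠ v : IsDedekindDomain.HeightOneSpectrum (NumberField.RingOfIntegers K) in cofinite, SatakeFrobCompatibleAt ι π.1 ρ v


namespace Cruxes.EvenArtinPlaneOfMaass.Birth

/-- **stub P₁ — Artin data of an even `σ`** — VERBATIM the route's support item `EvenArtinShadowData` (stmt-Langlands-13896; routine
Artin formalism over proved tree theorems: finite image, Kronecker–Weber for `det σ`, Euler pin seeded by `a_p = tr σ(Frob_p)`; size L).
[cite: SerreAbelianLadic1968, Ch. I §2] [cite: DiamondShurman2005, §9.2] -/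
theorem stub_evenArtinShadowData : EvenArtinShadowData :=
  Summit.Langlands.Langlands.Theorems.HolomorphicShadow.EvenArtinData.evenArtinShadowData

/-- **stub P₂ — the Maass-eigenform dictionary with L-algebraicity** (the support MaassEigenformStrongArtin 13895 — Gelbart 1975 §3,
Bump 1997 §3.6: `Γ₀(L)`-automorphic Maass lift + Euler pin ⇒ cuspidal `P` on `GL₂(𝔸_ℚ)` with Satake–Frobenius matching a.e. — UPGRADED
by `P.1.IsLAlgebraic`: the lift is a `λ = 1/4` eigenfunction, so `P_∞` is the even principal series of parameter `(0,0)`,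
`NonRegularWeightBarrier.isLAlgebraic_maassQuarterInfinityType`).  True in substance; open in the tree (classical Maass form → adelic
automorphic representation is Lean work). [cite: Gelbart1975, §3] [cite: Bump1997, §3.6] [cite: BuzzardGeeLMS2014, Def. 3.1.1] -/
theorem stub_maassDictionaryLAlgebraic :
    let K0 : ℝ → ℝ := fun x => ∫ t in Set.Ioi (0 : ℝ), Real.exp (-(x * Real.cosh t)); let maass : (ℕ → ℂ) → ℂ → UpperHalfPlane → ℂ := fun a ε z => ∑' n : ℕ, a (n + 1) * ((Real.sqrt z.im * K0 (2 * Real.pi * ((n : ℝ) + 1) * z.im) : ℝ) : ℂ) * (Complex.exp (2 * Real.pi * Complex.I * ((n : ℂ) + 1) * (z.re : ℂ)) + ε * Complex.exp (-(2 * Real.pi * Complex.I * ((n : ℂ) + 1) * (z.re : ℂ)))); let EulerPin : Literature.NumberTheory.GaloisRepresentations.FramedGaloisRep ℚ ℂ 2 → (N : ℕ) → DirichletCharacter ℂ N → (ℕ → ℂ) → Prop := fun σ N χ a => a 1 = 1 ∧ (∀ m n : ℕ, Nat.Coprime m n → a (m * n) = a m * a n) ∧ (∀ p : ℕ, p.Prime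 → p ∣ N → ∀ j : ℕ, a (p ^ (j + 1)) = 0) ∧ (∀ p : ℕ, p.Prime → ¬ p ∣ N → (∀ j : ℕ, a (p ^ (j + 2)) = a p * a (p ^ (j + 1)) - χ (p : ZMod N) * a (p ^ j)) ∧ ∀ v : IsDedekindDomain.HeightOneSpectrum (NumberField.RingOfIntegers ℚ), (p : NumberField.RingOfIntegers ℚ) ∈ v.asIdeal → Literature.NumberTheory.GaloisRepresentations.FramedGaloisRep.IsUnramifiedAt v σ ∧ Literature.NumberTheory.GaloisRepresentations.FramedGaloisRep.HasFrobCharpolyAt v (Polynomial.X ^ 2 - Polynomial.C (a p) * Polynomial.X + Polynomial.C (χ (p : ZMod N))) σ); ∀ σ : Literature.NumberTheory.GaloisRepresentations.FramedGaloisRep ℚ ℂ 2, σ.toGaloisRep.IsIrreducible → ∀ (N L : ℕ) (χ : DirichletCharacter ℂ N) (ε : ℂ) (a : ℕ → ℂ), 0 < N → N ∣ L → 0 < L → (ε = 1 ∨ ε = -1) → (∃ C A : ℝ, ∀ n : ℕ, ‖a n‖ ≤ C * ((n : ℝ) + 1) ^ A) → EulerPin σ N χ a → (∀ γ ∈ CongruenceSubgroup.Gamma0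 L, ∀ z : UpperHalfPlane, maass a ε (γ • z) = χ ((((γ : Matrix (Fin 2) (Fin 2) ℤ) 1 1 : ℤ) : ZMod N)) * maass a ε z) → ∃ (hcpt : Literature.NumberTheory.Automorphic.isCompact_glFiniteIntegralLevel 2 ℚ) (P : Literature.NumberTheory.Automorphic.CuspidalAutomorphicRepData 2 ℚ hcpt), P.1.IsLAlgebraic ∧ (∀ᶠ v : IsDedekindDomain.HeightOneSpectrum (NumberField.RingOfIntegers ℚ) in Filter.cofinite, ∃ α : Multiset ℂ, Literature.NumberTheory.Automorphic.AutomorphicRepData.HasSatakeParamAt P.1 v α ∧ Literature.NumberTheory.GaloisRepresentations.FramedGaloisRep.IsUnramifiedAt v σ ∧ Literature.NumberTheory.GaloisRepresentations.FramedGaloisRep.HasFrobCharpolyAt v (Literature.NumberTheory.Automorphic.satakePolynomial α) σ) := by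
  sorry

/-- **stub P₃ — complex-to-`ℓ`-adic transport on the even Artin plane over `ℚ`**: granted even strong Artin over `ℚ` in L-algebraic form
(every irreducible even `σ : Γ_ℚ → GL₂(ℂ)` has an L-algebraic cuspidal `P` with `satakePolynomial`-matching a.e.), every irreducible
even Artin-type `ρ : Γ_ℚ → GL₂(ℚ̄_ℓ)` (open kernel) has an L-algebraic cuspidal `π` with `SatakeFrobCompatibleAt ι π.1 ρ` a.e.  Content:
`σ := ι ∘ ρ^∨` is continuous (open kernel), irreducible and even; roots `ι⁻¹(α_j⁻¹)` of the arithmetic Frobenius (pattern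
`IrreducibleOffSectorArtinType.exists_lAdicDualTransport` / `eventually_satakeFrobCompatibleAt_lAdicDualTransport`).  Why it might fail:
only through a normalisation slip (dual / `ι`), repairable inside the proof. [cite: BuzzardGeeLMS2014, Conj. 3.2.2 and Rem. 3.2.5]
[cite: DeligneSerreASENS1974, §8] -/
theorem stub_complexToLAdicTransport :
    (∀ σ : Literature.NumberTheory.GaloisRepresentations.FramedGaloisRep ℚ ℂ 2, σ.toGaloisRep.IsIrreducible → (∀ (φ : ℚ →+* ℝ) (c : Field.absoluteGaloisGroup ℚ), Literature.NumberTheory.GaloisRepresentations.IsComplexConjugation φ c → Matrix.GeneralLinearGroup.det (σ c) = 1) → ∃ (hcpt : Literature.NumberTheory.Automorphic.isCompact_glFiniteIntegralLevel 2 ℚ) (P : Literature.NumberTheory.Automorphic.CuspidalAutomorphicRepData 2 ℚ hcpt), P.1.IsLAlgebraic ∧ (∀ᶠ v : IsDedekindDomain.HeightOneSpectrum (NumberField.RingOfIntegers ℚ) in Filter.cofinite, ∃ α : Multiset ℂ, Literature.NumberTheory.Automorphic.AutomorphicRepData.HasSatakeParamAt P.1 v α ∧ Literature.NumberTheory.GaloisRepresentations.FramedGaloisRep.IsUnramifiedAt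 v σ ∧ Literature.NumberTheory.GaloisRepresentations.FramedGaloisRep.HasFrobCharpolyAt v (Literature.NumberTheory.Automorphic.satakePolynomial α) σ)) →
    ∀ (hcpt : Literature.NumberTheory.Automorphic.isCompact_glFiniteIntegralLevel 2 ℚ) (ℓ : ℕ) [Fact ℓ.Prime] (ι : PadicAlgCl ℓ ≃+* ℂ) (ρ : Literature.NumberTheory.GaloisRepresentations.FramedGaloisRep ℚ (PadicAlgCl ℓ) 2), ρ.toGaloisRep.IsIrreducible → IsOpen (ρ.toMonoidHom.ker : Set (Field.absoluteGaloisGroup ℚ)) → (∀ (φ : ℚ →+* ℝ) (c : Field.absoluteGaloisGroup ℚ), Literature.NumberTheory.GaloisRepresentations.IsComplexConjugation φ c → Matrix.GeneralLinearGroup.det (ρ c) = 1) → ∃ π : Literature.NumberTheory.Automorphic.CuspidalAutomorphicRepData 2 ℚ hcpt, π.1.IsLAlgebraic ∧ ∀ᶠ v : IsDedekindDomain.HeightOneSpectrum (NumberField.RingOfIntegers ℚ) in cofinite, SatakeFrobCompatibleAt ι π.1 ρ v :=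
  Summit.Langlands.Langlands.Theorems.HolomorphicShadow.complexToLAdicTransport_evenArtinPlane

/-- **stub P₄ — transport along the unique `K ≃+* ℚ`**: the plane statement for every number field `K` with `Module.finrank ℚ K = 1`
from the case `K = ℚ` (transport of framed Galois representations, places, levels and cuspidal automorphic representation data along a
field isomorphism; pure formalization debt, no mathematics). [folklore] [cite: BuzzardGeeLMS2014, §3.1] -/
theorem stub_rationalFieldTransport :
    (∀ (hcpt : Literature.NumberTheory.Automorphic.isCompact_glFiniteIntegralLevel 2 ℚ) (ℓ : ℕ) [Fact ℓ.Prime] (ι : PadicAlgCl ℓ ≃+* ℂ) (ρ : Literature.NumberTheory.GaloisRepresentations.FramedGaloisRep ℚ (PadicAlgCl ℓ) 2), ρ.toGaloisRep.IsIrreducible → IsOpen (ρ.toMonoidHom.ker : Set (Field.absoluteGaloisGroup ℚ)) → (∀ (φ : ℚ →+* ℝ) (c : Field.absoluteGaloisGroup ℚ), Literature.NumberTheory.GaloisRepresentations.IsComplexConjugation φ c → Matrix.GeneralLinearGroup.det (ρ c) = 1) → ∃ π : Literature.NumberTheory.Automorphic.CuspidalAutomorphicRepData 2 ℚ hcpt,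 π.1.IsLAlgebraic ∧ ∀ᶠ v : IsDedekindDomain.HeightOneSpectrum (NumberField.RingOfIntegers ℚ) in cofinite, SatakeFrobCompatibleAt ι π.1 ρ v) →
    ∀ (K : Type) [Field K] [NumberField K], Module.finrank ℚ K = 1 → ∀ (hcpt : Literature.NumberTheory.Automorphic.isCompact_glFiniteIntegralLevel 2 K) (ℓ : ℕ) [Fact ℓ.Prime] (ι : PadicAlgCl ℓ ≃+* ℂ) (ρ : Literature.NumberTheory.GaloisRepresentations.FramedGaloisRep K (PadicAlgCl ℓ) 2), ρ.toGaloisRep.IsIrreducible → IsOpen (ρ.toMonoidHom.ker : Set (Field.absoluteGaloisGroup K)) → (∀ (φ : K →+* ℝ) (c : Field.absoluteGaloisGroup K), Literature.NumberTheory.GaloisRepresentations.IsComplexConjugation φ c → Matrix.GeneralLinearGroup.det (ρ c) = 1) → ∃ π : Literature.NumberTheory.Automorphic.CuspidalAutomorphicRepData 2 K hcpt, π.1.IsLAlgebraic ∧ ∀ᶠ v : IsDedekindDomain.HeightOneSpectrum (NumberField.RingOfIntegers K) in cofinite, SatakeFrobCompatibleAt ι π.1 ρ v := by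
  sorry

/-- **B⁺ from its four stubs**: fix `σ` irreducible and even; P₁ gives an admissible Artin datum `(N, χ, ε, a)`; `H` gives a level `L`
(`N ∣ L`) at which the Maass lift is `Γ₀(L)`-automorphic with character `χ`; P₂ turns it into an L-algebraic cuspidal `P` matching `σ`
a.e.; P₃ transports to `ℓ`-adic coefficients over `ℚ`; P₄ to every `K` of degree one. -/
theorem EvenArtinPlaneOfMaass_of (h1 : EvenArtinShadowData)
    (h2 : let K0 : ℝ → ℝ := fun x => ∫ t in Set.Ioi (0 : ℝ), Real.exp (-(x * Real.cosh t)); let maass : (ℕ → ℂ) → ℂ → UpperHalfPlane → ℂ := fun a ε z => ∑' n : ℕ, a (n + 1) * ((Real.sqrt z.im * K0 (2 * Real.pi * ((n : ℝ) + 1) * z.im) : ℝ) : ℂ) * (Complex.exp (2 * Real.pi * Complex.I * ((n : ℂ) + 1) * (z.re : ℂ)) + ε * Complex.exp (-(2 * Real.pi * Complex.I * ((n : ℂ) + 1) * (z.re : ℂ)))); let EulerPin : Literature.NumberTheory.GaloisRepresentations.FramedGaloisRep ℚ ℂ 2 → (N : ℕ) → DirichletCharacter ℂ N → (ℕ → ℂ)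 → Prop := fun σ N χ a => a 1 = 1 ∧ (∀ m n : ℕ, Nat.Coprime m n → a (m * n) = a m * a n) ∧ (∀ p : ℕ, p.Prime → p ∣ N → ∀ j : ℕ, a (p ^ (j + 1)) = 0) ∧ (∀ p : ℕ, p.Prime → ¬ p ∣ N → (∀ j : ℕ, a (p ^ (j + 2)) = a p * a (p ^ (j + 1)) - χ (p : ZMod N) * a (p ^ j)) ∧ ∀ v : IsDedekindDomain.HeightOneSpectrum (NumberField.RingOfIntegers ℚ), (p : NumberField.RingOfIntegers ℚ) ∈ v.asIdeal → Literature.NumberTheory.GaloisRepresentations.FramedGaloisRep.IsUnramifiedAt v σ ∧ Literature.NumberTheory.GaloisRepresentations.FramedGaloisRep.HasFrobCharpolyAt v (Polynomial.X ^ 2 - Polynomial.C (a p) * Polynomial.X + Polynomial.C (χ (p : ZMod N))) σ); ∀ σ : Literature.NumberTheory.GaloisRepresentations.FramedGaloisRep ℚ ℂ 2, σ.toGaloisRep.IsIrreducible → ∀ (N L : ℕ) (χ : DirichletCharacter ℂ N) (ε : ℂ) (a : ℕ → ℂ), 0 < N → N ∣ L → 0 < L → (ε = 1 ∨ ε = -1)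 → (∃ C A : ℝ, ∀ n : ℕ, ‖a n‖ ≤ C * ((n : ℝ) + 1) ^ A) → EulerPin σ N χ a → (∀ γ ∈ CongruenceSubgroup.Gamma0 L, ∀ z : UpperHalfPlane, maass a ε (γ • z) = χ ((((γ : Matrix (Fin 2) (Fin 2) ℤ) 1 1 : ℤ) : ZMod N)) * maass a ε z) → ∃ (hcpt : Literature.NumberTheory.Automorphic.isCompact_glFiniteIntegralLevel 2 ℚ) (P : Literature.NumberTheory.Automorphic.CuspidalAutomorphicRepData 2 ℚ hcpt), P.1.IsLAlgebraic ∧ (∀ᶠ v : IsDedekindDomain.HeightOneSpectrum (NumberField.RingOfIntegers ℚ) in Filter.cofinite, ∃ α : Multiset ℂ, Literature.NumberTheory.Automorphic.AutomorphicRepData.HasSatakeParamAt P.1 v α ∧ Literature.NumberTheory.GaloisRepresentations.FramedGaloisRep.IsUnramifiedAt v σ ∧ Literature.NumberTheory.GaloisRepresentations.FramedGaloisRep.HasFrobCharpolyAt v (Literature.NumberTheory.Automorphic.satakePolynomial α) σ))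
    (h3 : (∀ σ : Literature.NumberTheory.GaloisRepresentations.FramedGaloisRep ℚ ℂ 2, σ.toGaloisRep.IsIrreducible → (∀ (φ : ℚ →+* ℝ) (c : Field.absoluteGaloisGroup ℚ), Literature.NumberTheory.GaloisRepresentations.IsComplexConjugation φ c → Matrix.GeneralLinearGroup.det (σ c) = 1) → ∃ (hcpt : Literature.NumberTheory.Automorphic.isCompact_glFiniteIntegralLevel 2 ℚ) (P : Literature.NumberTheory.Automorphic.CuspidalAutomorphicRepData 2 ℚ hcpt), P.1.IsLAlgebraic ∧ (∀ᶠ v : IsDedekindDomain.HeightOneSpectrum (NumberField.RingOfIntegers ℚ) in Filter.cofinite, ∃ α : Multiset ℂ, Literature.NumberTheory.Automorphic.AutomorphicRepData.HasSatakeParamAt P.1 v α ∧ Literature.NumberTheory.GaloisRepresentations.FramedGaloisRep.IsUnramifiedAt v σ ∧ Literature.NumberTheory.GaloisRepresentations.FramedGaloisRep.HasFrobCharpolyAt v (Literature.NumberTheory.Automorphic.satakePolynomial α) σ)) → ∀ (hcpt : Literature.NumberTheory.Automorphic.isCompact_glFiniteIntegralLevel 2 ℚ) (ℓ : ℕ)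 [Fact ℓ.Prime] (ι : PadicAlgCl ℓ ≃+* ℂ) (ρ : Literature.NumberTheory.GaloisRepresentations.FramedGaloisRep ℚ (PadicAlgCl ℓ) 2), ρ.toGaloisRep.IsIrreducible → IsOpen (ρ.toMonoidHom.ker : Set (Field.absoluteGaloisGroup ℚ)) → (∀ (φ : ℚ →+* ℝ) (c : Field.absoluteGaloisGroup ℚ), Literature.NumberTheory.GaloisRepresentations.IsComplexConjugation φ c → Matrix.GeneralLinearGroup.det (ρ c) = 1) → ∃ π : Literature.NumberTheory.Automorphic.CuspidalAutomorphicRepData 2 ℚ hcpt, π.1.IsLAlgebraic ∧ ∀ᶠ v : IsDedekindDomain.HeightOneSpectrum (NumberField.RingOfIntegers ℚ) in cofinite, SatakeFrobCompatibleAt ι π.1 ρ v)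
    (h4 : (∀ (hcpt : Literature.NumberTheory.Automorphic.isCompact_glFiniteIntegralLevel 2 ℚ) (ℓ : ℕ) [Fact ℓ.Prime] (ι : PadicAlgCl ℓ ≃+* ℂ) (ρ : Literature.NumberTheory.GaloisRepresentations.FramedGaloisRep ℚ (PadicAlgCl ℓ) 2), ρ.toGaloisRep.IsIrreducible → IsOpen (ρ.toMonoidHom.ker : Set (Field.absoluteGaloisGroup ℚ)) → (∀ (φ : ℚ →+* ℝ) (c : Field.absoluteGaloisGroup ℚ), Literature.NumberTheory.GaloisRepresentations.IsComplexConjugation φ c → Matrix.GeneralLinearGroup.det (ρ c) = 1) → ∃ π : Literature.NumberTheory.Automorphic.CuspidalAutomorphicRepData 2 ℚ hcpt, π.1.IsLAlgebraic ∧ ∀ᶠ v : IsDedekindDomain.HeightOneSpectrum (NumberField.RingOfIntegers ℚ) in cofinite, SatakeFrobCompatibleAt ι π.1 ρ v) → ∀ (K : Type) [Field K] [NumberField K], Module.finrank ℚ K = 1 → ∀ (hcpt : Literature.NumberTheory.Automorphic.isCompact_glFiniteIntegralLevel 2 K) (ℓ : ℕ) [Fact ℓ.Prime] (ι : PadicAlgCl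 ℓ ≃+* ℂ) (ρ : Literature.NumberTheory.GaloisRepresentations.FramedGaloisRep K (PadicAlgCl ℓ) 2), ρ.toGaloisRep.IsIrreducible → IsOpen (ρ.toMonoidHom.ker : Set (Field.absoluteGaloisGroup K)) → (∀ (φ : K →+* ℝ) (c : Field.absoluteGaloisGroup K), Literature.NumberTheory.GaloisRepresentations.IsComplexConjugation φ c → Matrix.GeneralLinearGroup.det (ρ c) = 1) → ∃ π : Literature.NumberTheory.Automorphic.CuspidalAutomorphicRepData 2 K hcpt, π.1.IsLAlgebraic ∧ ∀ᶠ v : IsDedekindDomain.HeightOneSpectrum (NumberField.RingOfIntegers K) in cofinite, SatakeFrobCompatibleAt ι π.1 ρ v) :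
    EvenArtinPlaneOfMaass := by
  intro hH
  refine h4 (h3 ?_)
  intro σ hirr heven
  obtain ⟨N, χ, ε, a, hN, hε, hpar, hgr, hpin⟩ := h1 σ hirr heven
  obtain ⟨L, hL, hNL, haut⟩ := hH σ hirr N χ ε a hN hε hpar hgr hpin
  exact h2 σ hirr N L χ ε a hN hNL hL hε hgr hpin haut

/-- The composition with the stubs plugged in: `EvenArtinPlaneOfMaass` modulo exactly {P₁, P₂, P₃, P₄}. -/
theorem EvenArtinPlaneOfMaass_of_stubs : EvenArtinPlaneOfMaass :=
  EvenArtinPlaneOfMaass_of stub_evenArtinShadowData stub_maassDictionaryLAlgebraic stub_complexToLAdicTransport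
    stub_rationalFieldTransport

end Cruxes.EvenArtinPlaneOfMaass.Birth

end Summit.Langlands.Langlands.Theses.HolomorphicShadow
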